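import Mathlib
import HarnessLib
import Literature.Geometry.Lorentzian.Stationary
import Literature.Geometry.Lorentzian.CausalityOpennessProofs
import Literature.Geometry.Lorentzian.NomizuKillingExtension
import Literature.Geometry.Lorentzian.NomizuKillingExtensionChart
import Literature.Geometry.Manifold.SimplyConnectedSublevelNhds

/-!
# `NonTrappingHawkingRigidity` (crux stmt-FinalStateConjecture-13896), line `azimuthal-partial-analyticity`
# — stub `stub_pointContinuationAnalytic` (S2a)

Registered stub S2a of the lead's skeleton `Cruxes/NonTrappingHawkingRigidity/Lines/azimuthal_partial_analyticity.lean`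
(namespace `…Cruxes.NonTrappingHawkingRigidity.AzimuthalPartialAnalyticity`), PROVED modulo its
leading hypothesis, the named fact `PseudoRiemannianMetric.Nomizu1960_killing_extension`
(Nomizu 1960 / Chruściel 1997, Thm. 2.1, `NomizuKillingExtension.lean`). The statement below is the
REGISTERED signature, letter for letter (Literature vocabulary only).

**Statement (the lever in the fully analytic region = local Nomizu).** Assuming Nomizu's extension
theorem: in a stationary black hole spacetime `𝓑`, let `L` be a local `T`-commuting Killing field
on an open `D ⊆ doc` (smooth on `D`, Killing equation on `D`, `[T, L] = 0` on `D`), `q ∈ doc` a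
point supported by `D` through a NON-NULL level of a function `f` (on an open `N ∋ q`: `f` smooth,
`df_q = g(n_q, ·)` with `g(n_q, n_q) ≠ 0`, and `D ∩ N ∩ doc = {f < f q} ∩ N ∩ doc`), and suppose
the metric is real-analytic in a chart `ψ` of the maximal `C^∞` atlas around `q` (all components
`p ↦ g(dψ⁻¹ a, dψ⁻¹ b)` analytic on `ψ.target`). Then `(D, L)` has a one-step continuation at `q`:
an open `W ∋ q` inside the d.o.c. and a local `T`-commuting Killing field `L'` on `W` with
`L' = L` on `W ∩ D`.

**Proof.** (1) `df_q ≠ 0` (non-null gradient), so by the slice chart of the regular level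
(`Literature.Geometry.Manifold.exists_isSimplyConnected_nhds_inter_sublevel_isConnected`,
Lee 2013, Thm. 5.12) `q` has an open SIMPLY CONNECTED neighbourhood `V ⊆ ψ.source ∩ N ∩ doc` with
`V ∩ {f < f q} = V ∩ D` CONNECTED and non-empty. (2) The restricted chart `ψ|_V` is a chart of the
maximal atlas with simply connected target `ψ(V)` on which the metric components are analytic, and
`ψ(V ∩ D)` is connected. (3) Local Nomizu in that chart
(`Literature.Geometry.Lorentzian.MaxAtlasChart.exists_killingOn_source_mlieBracket_zero_eqOn`,
`NomizuKillingExtensionChart.lean`): transport `L` to the chart target along `Ψ = ψ⁻¹` (a local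
isometry onto `Ψ^* g`, whose values are those of a `C^ω` metric on the open, boundaryless, simply
connected submanifold `ψ(V) ⊆ ℝ⁴`), extend it by Nomizu's theorem to a global Killing field of the
target, bring it back as a Killing field `L'` of `g` on `V` equal to `L` on `V ∩ D`; the commutator
`[T, L']` is handled on the target, where `[Ψ^*T, Ψ^*L']` is a global Killing field (O'Neill 1983,
Ch. 9, Lemma 9.28 ff.) vanishing on the non-empty open `Ψ⁻¹(D)` (there `L' = L` as germs and
`[T, L] = 0`), hence everywhere by one-jet rigidity (O'Neill 1983, Ch. 9, Lemma 9.28).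
(4) `W := V`. Helper bricks (all proved, Literature): `AnalyticChartMetric.lean` (p152714),
`MaxAtlasChartKilling.lean` (p152945), `SimplyConnectedSublevelNhds.lean` (p153263),
`NomizuKillingExtensionChart.lean` (p153491).
-/

noncomputable section

-- D-0017: single-problem summit, `Summit.<S>.<S>.…` by design
set_option linter.dupNamespace false

namespace Summit.FinalStateConjecture.FinalStateConjecture.Theorems.NonTrappingHawkingRigidity.AzimuthalPartialAnalyticity

open Set Filter Function Bundle TopologicalSpace VectorField Literature.Geometry.Lorentzian
  Literature.Geometry.Manifold
open scoped Manifold ContDiff Topology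

/-- **Stub S2a · pointContinuationAnalytic (registered signature, letter for letter) — the lever in
the fully analytic region = LOCAL NOMIZU.** Assuming Nomizu's extension theorem in the tree's `C^∞`
rendering (`PseudoRiemannianMetric.Nomizu1960_killing_extension`): a local `T`-commuting Killing
field `L` on an open `D ⊆ doc`, a point `q ∈ doc` supported by `D` through a non-null level of `f`,
and chartwise full analyticity of the metric at `q` give a one-step continuation of `(D, L)` at `q`.
See the module docstring for the proof (slice-chart neighbourhood with connected sub-level part,
restriction of the analytic chart, local Nomizu on the chart target, one-jet rigidity for the
commutator). Nomizu 1960, Thms. 1–2; Chruściel 1997, Thm. 2.1; O'Neill 1983, Ch. 9, Lemma 9.28;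
Lee 2013, Thm. 5.12. [cite: Chrusciel1997, Thm. 2.1] -/
theorem stub_pointContinuationAnalytic :
    PseudoRiemannianMetric.Nomizu1960_killing_extension →
    ∀ (𝓑 : StationaryAFBlackHole.{0}) [𝓑.metric.HasLeviCivita],
      ∀ (D : Set 𝓑.carrier) (L : Π x : 𝓑.carrier, TangentSpace (𝓡 4) x), IsOpen D → D ⊆ 𝓑.doc →
      (ContMDiffOn (𝓡 4) ((𝓡 4).prod 𝓘(ℝ, E4)) ((⊤ : ℕ∞) : WithTop ℕ∞)
          (fun x ↦ (Bundle.TotalSpace.mk' E4 x (L x) : TangentBundle (𝓡 4) 𝓑.carrier)) D ∧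
        (∀ x ∈ D, ∀ v w : TangentSpace (𝓡 4) x,
          𝓑.metric.val x (𝓑.metric.leviCivita L x v) w + 𝓑.metric.val x v (𝓑.metric.leviCivita L x w) = 0) ∧
        ∀ x ∈ D, VectorField.mlieBracket (𝓡 4) 𝓑.killing L x = 0) →
      ∀ q ∈ 𝓑.doc, ∀ f : 𝓑.carrier → ℝ,
      (∃ N : Set 𝓑.carrier, IsOpen N ∧ q ∈ N ∧
        ContMDiffOn (𝓡 4) 𝓘(ℝ, ℝ) ((⊤ : ℕ∞) : WithTop ℕ∞) f N ∧
        (∃ nq : TangentSpace (𝓡 4) q, 𝓑.metric.val q nq nq ≠ 0 ∧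
          ∀ w : TangentSpace (𝓡 4) q, mfderiv (𝓡 4) 𝓘(ℝ, ℝ) f q w = 𝓑.metric.val q nq w) ∧
        ∀ x ∈ N ∩ 𝓑.doc, x ∈ D ↔ f x < f q) →
      (∃ ψ ∈ IsManifold.maximalAtlas (𝓡 4) ((⊤ : ℕ∞) : WithTop ℕ∞) 𝓑.carrier,
        q ∈ ψ.source ∧ ∀ a b : E4, AnalyticOnNhd ℝ
          (fun p : E4 ↦ 𝓑.metric.val (ψ.symm p) (mfderiv 𝓘(ℝ, E4) (𝓡 4) ψ.symm p a)
            (mfderiv 𝓘(ℝ, E4) (𝓡 4) ψ.symm p b)) ψ.target) →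
      (∃ (W : Set 𝓑.carrier) (L' : Π x : 𝓑.carrier, TangentSpace (𝓡 4) x),
        IsOpen W ∧ q ∈ W ∧ W ⊆ 𝓑.doc ∧
        (ContMDiffOn (𝓡 4) ((𝓡 4).prod 𝓘(ℝ, E4)) ((⊤ : ℕ∞) : WithTop ℕ∞)
            (fun x ↦ (Bundle.TotalSpace.mk' E4 x (L' x) : TangentBundle (𝓡 4) 𝓑.carrier)) W ∧
          (∀ x ∈ W, ∀ v w : TangentSpace (𝓡 4) x,
            𝓑.metric.val x (𝓑.metric.leviCivita L' x v) w + 𝓑.metric.val x v (𝓑.metric.leviCivita L' x w) = 0) ∧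
          ∀ x ∈ W, VectorField.mlieBracket (𝓡 4) 𝓑.killing L' x = 0) ∧
        ∀ x ∈ W ∩ D, L' x = L x) := by
  intro hN 𝓑 _ D L hDo hDdoc hLK q hq f hNN hAn
  obtain ⟨hLs, hLk, hTL⟩ := hLK
  obtain ⟨N, hNo, hqN, hfN, ⟨nq, hnq, hdf⟩, hND⟩ := hNN
  obtain ⟨ψ, hψ, hqψ, hA⟩ := hAn
  set g := 𝓑.metric.toPseudoRiemannianMetric with hg
  -- the d.o.c. is open
  have hdoc : IsOpen 𝓑.doc :=
    𝓑.isOpen_doc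
      (LorentzianMetric.isOpen_chronologicalFuture_holds_of_boundaryless (g := 𝓑.metric)
        (τ := 𝓑.timeOrientation))
      (LorentzianMetric.isOpen_chronologicalPast_holds_of_boundaryless (g := 𝓑.metric)
        (τ := 𝓑.timeOrientation))
  -- (1) a simply connected neighbourhood `V ⊆ ψ.source ∩ N ∩ doc` with connected sub-level part
  set U : Set 𝓑.carrier := ψ.source ∩ (N ∩ 𝓑.doc) with hU
  have hUo : IsOpen U := ψ.open_source.inter (hNo.inter hdoc)
  have hqU : q ∈ U := ⟨hqψ, hqN, hq⟩
  have hdfq : mfderiv (𝓡 4) 𝓘(ℝ, ℝ) f q ≠ 0 := by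
    intro h0
    apply hnq
    have h1 := hdf nq
    rw [h0] at h1
    exact h1.symm
  obtain ⟨V, hVo, hqV, hVU, hVsc, hVconn⟩ :=
    exists_isSimplyConnected_nhds_inter_sublevel_isConnected hUo (hfN.mono fun x hx ↦ hx.2.1)
      hqU hdfq
  have hVψ : V ⊆ ψ.source := fun x hx ↦ (hVU hx).1
  have hVdoc : V ⊆ 𝓑.doc := fun x hx ↦ (hVU hx).2.2
  -- (2) the restricted chart `ψ|_V`
  set ψV := ψ.restr V with hψV_def
  have hψV : ψV ∈ IsManifold.maximalAtlas (𝓡 4) ∞ 𝓑.carrier := restr_mem_maximalAtlas _ hψ hVo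
  have hsrc : ψV.source = V := by
    rw [hψV_def, ψ.restr_source' V hVo, inter_eq_right.2 hVψ]
  have htgt : ψV.target ⊆ ψ.target := by
    rw [hψV_def, restr_target_eq_image ψ hVo hVψ]
    exact (image_mono hVψ).trans ψ.image_source_eq_target.le
  have hA' : ∀ a b : E4, AnalyticOnNhd ℝ
      (fun p : E4 ↦ g.val (ψV.symm p) (mfderiv 𝓘(ℝ, E4) (𝓡 4) ψV.symm p a)
        (mfderiv 𝓘(ℝ, E4) (𝓡 4) ψV.symm p b)) ψV.target := fun a b ↦
    (hA a b).mono htgt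
  have hsc : IsSimplyConnected ψV.target := isSimplyConnected_restr_target ψ hVo hVψ hVsc
  have hVD : V ∩ D = V ∩ {x | f x < f q} := by
    ext x
    constructor
    · rintro ⟨hxV, hxD⟩
      exact ⟨hxV, (hND x ⟨(hVU hxV).2.1, (hVU hxV).2.2⟩).1 hxD⟩
    · rintro ⟨hxV, hfx⟩
      exact ⟨hxV, (hND x ⟨(hVU hxV).2.1, (hVU hxV).2.2⟩).2 hfx⟩
  have hDc : IsConnected (ψV '' (ψV.source ∩ D)) := by
    rw [hψV_def, image_restr_source_inter ψ hVo hVψ D, hVD]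
    exact isConnected_image_of_subset_source ψ (inter_subset_left.trans hVψ) hVconn
  -- (3) local Nomizu in the chart `ψ|_V`, with the commutator
  have hL : g.IsKillingFieldOn L D := ⟨hLs, hLk⟩
  have hT : g.IsKillingField 𝓑.killing := 𝓑.isStationaryKilling.isKillingField
  obtain ⟨L', hL'K, hTL', hL'eq⟩ :=
    MaxAtlasChart.exists_killingOn_source_mlieBracket_zero_eqOn hN g hψV hA' hsc hDo hDc hL hT hTL
  -- (4) `W := V`
  rw [hsrc] at hL'K hTL' hL'eq
  exact ⟨V, L', hVo, hqV, hVdoc, ⟨hL'K.1, hL'K.2, hTL'⟩, hL'eq⟩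

end Summit.FinalStateConjecture.FinalStateConjecture.Theorems.NonTrappingHawkingRigidity.AzimuthalPartialAnalyticity

end
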